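import Mathlib
import Literature.Probability.LatticeModels.ProdBernoulliIndependence
import Literature.Probability.LatticeModels.SahiThirdOrderCorrelation
import Literature.Probability.Percolation.PercolationEvents
import Literature.Computation.FiniteGraph.ReliabilityBridge
import Literature.Probability.Percolation.BergKahnLogSupermodular
import HarnessLib

/-!
# BergKahnAvoidance

Topic `Literature/Probability/Percolation`. Named literature fact(s) relocated by the gate from `Summits/CriticalPhenomena/PercolationContinuityZ3/Theorems/PercNearOneGluingNoHeavyLowerTailAvoidanceTriples.lean`
(accept-time relocation of `[cite]`d propositions written inline in a Summits proposal; human ruling 2026-08-15).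
Sources: VandenbergHaggstromKahn2005, VandenbergKahn2001.

* `Literature.Probability.Percolation.BergKahnAvoidanceLSM`
* `Literature.Probability.Percolation.BergKahnAvoidanceLSM_holds` — the fact is PROVED in the tree (`BergKahn.bergKahn_avoidance`,
  `Literature/Probability/Percolation/BergKahnLogSupermodular.lean`, prim-sahi-p2 gen 3).
-/

namespace Literature.Probability.Percolation

open MeasureTheory Literature.Probability.Percolation Literature.Probability.LatticeModels
open Literature.Computation.FiniteGraph (measurableSet_of_fintype)

/-- **van den Berg–Kahn (2001), Theorem 1.2 with `A = B = ∅`** (= van den Berg–Häggström–Kahn 2006, Theorem 1.1 with trivial `A, B`): for Bernoulli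
bond percolation with arbitrary edge probabilities on a finite graph, a vertex `s` and vertex sets `X, Y`,
`P(s ↛ X)·P(s ↛ Y) ≤ P(s ↛ X ∩ Y)·P(s ↛ X ∪ Y)`, where `{s ↛ X}` is the event that no vertex of `X` is joined to `s` by an open path
(`R_X` in the source; `R_X ∩ R_Y = R_{X ∪ Y}`) — the avoidance probabilities of the open cluster of `s` are log-supermodular.  Here on the
complete graph of a finite vertex type with edge weights `w` (weight-zero edges are absent edges).
[cite: VandenbergKahn2001, Thm 1.2 (p. 123)] [cite: VandenbergHaggstromKahn2005, Thm 1.1] [file Probability/Percolation/BergKahnAvoidance] -/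
def BergKahnAvoidanceLSM : Prop :=
  ∀ (V : Type) [Fintype V] (w : Sym2 V → unitInterval) (s : V) (X Y : Set V),
    (prodBernoulli w).real {ω : BondConfig V | ∀ x ∈ X, ω ∉ openConn s x} *
        (prodBernoulli w).real {ω : BondConfig V | ∀ x ∈ Y, ω ∉ openConn s x} ≤
      (prodBernoulli w).real {ω : BondConfig V | ∀ x ∈ X ∩ Y, ω ∉ openConn s x} *
        (prodBernoulli w).real {ω : BondConfig V | ∀ x ∈ X ∪ Y, ω ∉ openConn s x}

/-- **van den Berg–Kahn's avoidance inequality HOLDS** — discharged by the tree's formalisation `BergKahn.bergKahn_avoidance` of the source's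
proof (induction on the vertex set, Ahlswede–Daykin). [cite: VandenbergKahn2001, Thm 1.2 (p. 123)] -/
theorem BergKahnAvoidanceLSM_holds : BergKahnAvoidanceLSM := fun V _ w s X Y => by
  classical exact BergKahn.bergKahn_avoidance w s X Y

end Literature.Probability.Percolation
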